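import Summits.CriticalPhenomena.Ising3DConformalLimit.Theorems.SynchronousCouplingRotationJoiningIsotropyDefs
import Summits.CriticalPhenomena.Ising3DConformalLimit.Theorems.EnergyNotSigmaSquaredMoebiusLimitExistsLocallyBounded
import Literature.Probability.LatticeModels.CriticalWickIff
import HarnessLib

/-!
# Route `SynchronousCoupling`, crux `RotationJoining` (stmt-CriticalPhenomena-18763), line `SketchIdeator2` (reshape 2) —
# the constrained four-point sum (lead's tool for the near-field control of `stub_isotropyTransfer`)

For finite sets `Q_a, Q_b ⊆ ℤ³` and a set `C ⊆ Q_a × Q_b` of pairs which are `ρ`-CLOSE (`|c₁ᵢ − c₂ᵢ| ≤ ρ`), the four-point sum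
over pairs of constrained pairs is controlled by two-point ROW SUMS: with `U` a bound for all row sums `Σ_{q} ⟨σ_pσ_q⟩` over
`Q_a ∪ Q_b` and `u` a bound for the row sums over `ρ`-close sites,
`Σ_{c,c' ∈ C} ⟨σ_{c₁}σ_{c₂}σ_{c'₁}σ_{c'₂}⟩_{β_c} ≤ (|Q_a| u)² + 2 |Q_a| (2ρ+1)³ U²`
— the Lebowitz/Newman four-point bound `⟨σσσσ⟩ ≤ Σ_{3 pairings} ⟨σσ⟩⟨σσ⟩` (`criticalCorr_le_pairingSum`, `pairingSum_two`) and
bookkeeping of the three pairings. References: J. L. Lebowitz, Comm. Math. Phys. 35 (1974); C. M. Newman, Z. Wahrsch. 33 (1975);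
M. Aizenman, H. Duminil-Copin, Ann. Math. 194 (2021) §6.3. No definitions, no sorry.
-/

noncomputable section

namespace Summit.CriticalPhenomena.Ising3DConformalLimit.Cruxes.RotationJoining.RateSplitting

open Literature.Probability.LatticeModels Finset
open scoped BigOperators
open Summit.CriticalPhenomena.Ising3DConformalLimit.MoebiusLimitExistsOnlyInteraction (criticalCorr_le_pairingSum)

/-- **The four-point function is dominated by the three pairings** (Lebowitz / Newman):
`⟨σ_pσ_qσ_{p'}σ_{q'}⟩_{β_c} ≤ ⟨σ_pσ_q⟩⟨σ_{p'}σ_{q'}⟩ + ⟨σ_pσ_{p'}⟩⟨σ_qσ_{q'}⟩ + ⟨σ_pσ_{q'}⟩⟨σ_qσ_{p'}⟩`, the two-point functions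
written as `⟨σ₀σ_{y−x}⟩`. [cite: AizenmanDuminilCopinAnnals2021, arXiv:1912.07973 §6.3] -/
theorem criticalCorr_four_le_pairings (p q p' q' : Site 3) :
    criticalCorr 3 4 ![p, q, p', q'] ≤
      criticalTwoPoint 3 (q - p) * criticalTwoPoint 3 (q' - p') +
        criticalTwoPoint 3 (p' - p) * criticalTwoPoint 3 (q' - q) +
          criticalTwoPoint 3 (q' - p) * criticalTwoPoint 3 (p' - q) := by
  have h := criticalCorr_le_pairingSum 2 ![p, q, p', q']
  rw [pairingSum_two _ (fun a b => criticalCorr_two_pair_comm a b)] at h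
  simp only [Matrix.cons_val_zero, Matrix.cons_val_one, Matrix.cons_val] at h
  simpa only [criticalCorr_two_pair] using h

/-- Sums over a set of pairs `C ⊆ Q_a × Q_b` are iterated sums over the fibres `{q ∈ Q_b | (p, q) ∈ C}`. [folklore] -/
theorem sum_pairs_eq_sum_fibres {β : Type*} [AddCommMonoid β] (Qa Qb : Finset (Site 3)) (C : Finset (Site 3 × Site 3))
    (hC : C ⊆ Qa ×ˢ Qb) (f : Site 3 × Site 3 → β) :
    ∑ c ∈ C, f c = ∑ p ∈ Qa, ∑ q ∈ Qb.filter (fun q => (p, q) ∈ C), f (p, q) := by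
  classical
  have : C = (Qa ×ˢ Qb).filter (fun c => c ∈ C) := by
    ext c; constructor
    · intro hc; exact Finset.mem_filter.2 ⟨hC hc, hc⟩
    · intro hc; exact (Finset.mem_filter.1 hc).2
  conv_lhs => rw [this]
  rw [Finset.sum_filter, Finset.sum_product]
  refine Finset.sum_congr rfl fun p _ => ?_
  rw [Finset.sum_filter]

/-- The fibre of a set of `ρ`-close pairs over a point has at most `(2ρ+1)³` elements (it injects into the ball `box 3 ρ`
by `q ↦ q − p`). [folklore] -/
theorem card_fibre_le (Qb : Finset (Site 3)) (C : Finset (Site 3 × Site 3)) (ρ : ℕ)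
    (hclose : ∀ c ∈ C, ∀ i, |c.1 i - c.2 i| ≤ ρ) (p : Site 3) :
    ((Qb.filter (fun q => (p, q) ∈ C)).card : ℝ) ≤ (2 * (ρ:ℝ) + 1) ^ 3 := by
  classical
  have hinj : Set.InjOn (fun q : Site 3 => q - p) (Qb.filter (fun q => (p, q) ∈ C)) :=
    fun q _ q' _ h => sub_left_injective h
  have hsub : (Qb.filter (fun q => (p, q) ∈ C)).image (fun q => q - p) ⊆ box 3 ρ := by
    intro z hz
    rw [Finset.mem_image] at hz
    obtain ⟨q, hq, rfl⟩ := hz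
    rw [Finset.mem_filter] at hq
    rw [mem_box]
    intro i
    have := hclose _ hq.2 i
    simp only at this
    rw [abs_le] at this
    refine ⟨?_, ?_⟩ <;> rw [Pi.sub_apply] <;> omega
  have h := Finset.card_le_card hsub
  rw [Finset.card_image_of_injOn hinj, card_box] at h
  exact_mod_cast h

/-- The number of `ρ`-close pairs `C ⊆ Q_a × Q_b` is at most `|Q_a| (2ρ+1)³`. [folklore] -/
theorem card_closePairs_le (Qa Qb : Finset (Site 3)) (C : Finset (Site 3 × Site 3)) (hC : C ⊆ Qa ×ˢ Qb)
    (ρ : ℕ) (hclose : ∀ c ∈ C, ∀ i, |c.1 i - c.2 i| ≤ ρ) :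
    (C.card : ℝ) ≤ Qa.card * (2 * (ρ:ℝ) + 1) ^ 3 := by
  classical
  have h : (C.card : ℝ) = ∑ p ∈ Qa, ((Qb.filter (fun q => (p, q) ∈ C)).card : ℝ) := by
    have := sum_pairs_eq_sum_fibres Qa Qb C hC (fun _ => (1:ℝ))
    simp only [Finset.sum_const, nsmul_eq_mul, mul_one] at this
    exact this
  rw [h]
  calc ∑ p ∈ Qa, ((Qb.filter (fun q => (p, q) ∈ C)).card : ℝ) ≤ ∑ _p ∈ Qa, (2 * (ρ:ℝ) + 1) ^ 3 :=
        Finset.sum_le_sum fun p _ => card_fibre_le Qb C ρ hclose p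
    _ = Qa.card * (2 * (ρ:ℝ) + 1) ^ 3 := by rw [Finset.sum_const, nsmul_eq_mul]

/-- **The constrained four-point sum.** Let `C ⊆ Q_a × Q_b` (pairs), let `U ≥ 0` bound every two-point row sum over `Q_a` and
over `Q_b` (`Σ_{y ∈ Q} ⟨σ_xσ_y⟩ ≤ U` for every base point `x`), and let `u` bound the constrained row sums
`Σ_{q : (p,q) ∈ C} ⟨σ_pσ_q⟩`, `p ∈ Q_a`. Then
`Σ_{c,c'∈C} ⟨σ_{c₁}σ_{c₂}σ_{c'₁}σ_{c'₂}⟩_{β_c} ≤ (|Q_a| u)² + 2 |C| U²` (the three pairings: the "parallel" one is the square of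
the constrained pair sum, each "crossed" one is at most `|C| U²`). [cite: AizenmanDuminilCopinAnnals2021, arXiv:1912.07973 §6.3] -/
theorem fourPoint_constrained_le (Qa Qb : Finset (Site 3)) (C : Finset (Site 3 × Site 3)) (hC : C ⊆ Qa ×ˢ Qb)
    {U u : ℝ} (hU0 : 0 ≤ U)
    (hUa : ∀ x : Site 3, ∑ y ∈ Qa, criticalTwoPoint 3 (y - x) ≤ U)
    (hUb : ∀ x : Site 3, ∑ y ∈ Qb, criticalTwoPoint 3 (y - x) ≤ U)
    (hu : ∀ p ∈ Qa, ∑ q ∈ Qb.filter (fun q => (p, q) ∈ C), criticalTwoPoint 3 (q - p) ≤ u) :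
    ∑ c ∈ C, ∑ c' ∈ C, criticalCorr 3 4 ![c.1, c.2, c'.1, c'.2] ≤ (Qa.card * u) ^ 2 + 2 * C.card * U ^ 2 := by
  classical
  have hG : ∀ z, 0 ≤ criticalTwoPoint 3 z := criticalTwoPoint_nonneg'
  -- the close pair sum
  have hT : ∑ c ∈ C, criticalTwoPoint 3 (c.2 - c.1) ≤ Qa.card * u := by
    rw [sum_pairs_eq_sum_fibres Qa Qb C hC (fun c => criticalTwoPoint 3 (c.2 - c.1))]
    calc ∑ p ∈ Qa, ∑ q ∈ Qb.filter (fun q => (p, q) ∈ C), criticalTwoPoint 3 (q - p)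
        ≤ ∑ _p ∈ Qa, u := Finset.sum_le_sum fun p hp => hu p hp
      _ = Qa.card * u := by rw [Finset.sum_const, nsmul_eq_mul]
  have hT0 : 0 ≤ ∑ c ∈ C, criticalTwoPoint 3 (c.2 - c.1) := Finset.sum_nonneg fun c _ => hG _
  -- termwise pairing bound
  have step : ∑ c ∈ C, ∑ c' ∈ C, criticalCorr 3 4 ![c.1, c.2, c'.1, c'.2] ≤
      ∑ c ∈ C, ∑ c' ∈ C, (criticalTwoPoint 3 (c.2 - c.1) * criticalTwoPoint 3 (c'.2 - c'.1) +
        criticalTwoPoint 3 (c'.1 - c.1) * criticalTwoPoint 3 (c'.2 - c.2) +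
          criticalTwoPoint 3 (c'.2 - c.1) * criticalTwoPoint 3 (c'.1 - c.2)) :=
    Finset.sum_le_sum fun c _ => Finset.sum_le_sum fun c' _ => criticalCorr_four_le_pairings _ _ _ _
  refine step.trans ?_
  simp only [Finset.sum_add_distrib]
  -- T1 = (close pair sum)²
  have hT1 : ∑ c ∈ C, ∑ c' ∈ C, criticalTwoPoint 3 (c.2 - c.1) * criticalTwoPoint 3 (c'.2 - c'.1) ≤ (Qa.card * u) ^ 2 := by
    rw [← Finset.sum_mul_sum, ← sq]
    exact pow_le_pow_left₀ hT0 hT 2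
  -- crossed pairings: inner sums over `c'` as fibres over `p' ∈ Q_a`, drop the constraint on `q'`, two row sums
  have hcross : ∀ (f g : Site 3 × Site 3 → Site 3),
      (∀ c ∈ C, ∑ c' ∈ C, criticalTwoPoint 3 (c'.1 - f c) * criticalTwoPoint 3 (c'.2 - g c) ≤ U * U) := by
    intro f g c _
    rw [sum_pairs_eq_sum_fibres Qa Qb C hC (fun c' => criticalTwoPoint 3 (c'.1 - f c) * criticalTwoPoint 3 (c'.2 - g c))]
    calc ∑ p' ∈ Qa, ∑ q' ∈ Qb.filter (fun q => (p', q) ∈ C), criticalTwoPoint 3 (p' - f c) * criticalTwoPoint 3 (q' - g c)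
        ≤ ∑ p' ∈ Qa, ∑ q' ∈ Qb, criticalTwoPoint 3 (p' - f c) * criticalTwoPoint 3 (q' - g c) :=
          Finset.sum_le_sum fun p' _ => Finset.sum_le_sum_of_subset_of_nonneg (Finset.filter_subset _ _)
            fun q' _ _ => mul_nonneg (hG _) (hG _)
      _ = ∑ p' ∈ Qa, criticalTwoPoint 3 (p' - f c) * ∑ q' ∈ Qb, criticalTwoPoint 3 (q' - g c) := by
          simp only [Finset.mul_sum]
      _ ≤ ∑ p' ∈ Qa, criticalTwoPoint 3 (p' - f c) * U :=
          Finset.sum_le_sum fun p' _ => mul_le_mul_of_nonneg_left (hUb (g c)) (hG _)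
      _ = (∑ p' ∈ Qa, criticalTwoPoint 3 (p' - f c)) * U := by rw [Finset.sum_mul]
      _ ≤ U * U := mul_le_mul_of_nonneg_right (hUa (f c)) hU0
  have hT2 : ∑ c ∈ C, ∑ c' ∈ C, criticalTwoPoint 3 (c'.1 - c.1) * criticalTwoPoint 3 (c'.2 - c.2) ≤ C.card * U ^ 2 := by
    calc _ ≤ ∑ _c ∈ C, U * U := Finset.sum_le_sum (hcross (fun c => c.1) (fun c => c.2))
      _ = C.card * U ^ 2 := by rw [Finset.sum_const, nsmul_eq_mul, sq]
  have hT3 : ∑ c ∈ C, ∑ c' ∈ C, criticalTwoPoint 3 (c'.2 - c.1) * criticalTwoPoint 3 (c'.1 - c.2) ≤ C.card * U ^ 2 := by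
    have hswap : ∀ c ∈ C, ∑ c' ∈ C, criticalTwoPoint 3 (c'.2 - c.1) * criticalTwoPoint 3 (c'.1 - c.2) =
        ∑ c' ∈ C, criticalTwoPoint 3 (c'.1 - c.2) * criticalTwoPoint 3 (c'.2 - c.1) :=
      fun c _ => Finset.sum_congr rfl fun c' _ => mul_comm _ _
    rw [Finset.sum_congr rfl hswap]
    calc _ ≤ ∑ _c ∈ C, U * U := Finset.sum_le_sum (hcross (fun c => c.2) (fun c => c.1))
      _ = C.card * U ^ 2 := by rw [Finset.sum_const, nsmul_eq_mul, sq]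
  linarith

end Summit.CriticalPhenomena.Ising3DConformalLimit.Cruxes.RotationJoining.RateSplitting

end
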